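import Literature.Combinatorics.SimpleGraph.MengerTheorem
import Mathlib.Combinatorics.SimpleGraph.LineGraph
import HarnessLib

/-!
# Menger's theorem, edge form (= max-flow min-cut for unit capacities), via the line graph

Topic `Literature/Combinatorics/SimpleGraph`. From the set form of Menger's theorem
(`MengerTheorem.lean`) applied to the LINE GRAPH we derive the **edge form** (Diestel, *Graph
Theory*, Cor. 3.3.5 (ii) for two vertices; Ford–Fulkerson's max-flow min-cut theorem for `0/1`
capacities; here for vertex SETS `A`, `B`): in a finite graph, if every set of edges meeting all
`A`–`B` walks has at least `k` elements, then there are `k` pairwise edge-disjoint `A`–`B` walks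
(`exists_edgeDisjoint_walks_of_forall_isEdgeSeparator`), and conversely
(`card_le_card_of_edgeDisjoint`).

The dictionary with the line graph `G.lineGraph` (vertices = edges of `G`, adjacent iff distinct
and sharing an endpoint): a path of `G.lineGraph` from an edge at `a` yields a walk of `G` from `a`
using only the edges on the path (`exists_walk_of_lineGraph_walk`); a trail of `G` with at least one
edge yields a walk of `G.lineGraph` from its first to its last edge along its edges
(`exists_lineGraph_walk_of_isTrail`). Hence edge separators of `G` correspond to vertex separators
of `G.lineGraph` between `A' = {e : e ∩ A ≠ ∅}` and `B' = {e : e ∩ B ≠ ∅}`, and vertex-disjoint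
`A'`–`B'` paths of `G.lineGraph` to edge-disjoint `A`–`B` walks of `G`. (If `A ∩ B ≠ ∅` there is no
edge separator and trivial walks do the job.)

## References

* R. Diestel, *Graph Theory*, 5th ed. (2017), Thm. 3.3.1 and Cor. 3.3.5 [Diestel2017].
* L. R. Ford, D. R. Fulkerson, Maximal flow through a network, *Canad. J. Math.* 8 (1956) 399–404.
-/

namespace Literature.Combinatorics.SimpleGraph

open _root_.SimpleGraph

universe u

variable {V : Type u} {G : _root_.SimpleGraph V}

/-! ### Edge separators -/

/-- `F` is an **`A`–`B` edge separator** (edge cut) of `G`: every walk of `G` from `A` to `B` uses an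
edge of `F`. (There is none if `A ∩ B ≠ ∅`.) [cite: Diestel2017, §3.3 (edge version)] -/
def IsEdgeSeparator (G : _root_.SimpleGraph V) (A B : Set V) (F : Set (Sym2 V)) : Prop :=
  ∀ ⦃u v : V⦄, u ∈ A → v ∈ B → ∀ p : G.Walk u v, ∃ d ∈ p.edges, d ∈ F

/-- **The easy half of the edge form**: `k` pairwise edge-disjoint `A`–`B` walks force every finite
`A`–`B` edge separator to have at least `k` edges. [cite: Diestel2017, Cor. 3.3.5 (easy direction)] -/
theorem card_le_card_of_edgeDisjoint {A B : Set V} {k : ℕ} {s t : Fin k → V}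
    (w : ∀ i, G.Walk (s i) (t i)) (hs : ∀ i, s i ∈ A) (ht : ∀ i, t i ∈ B)
    (hdisj : ∀ i j, i ≠ j → List.Disjoint (w i).edges (w j).edges)
    {F : Finset (Sym2 V)} (hF : IsEdgeSeparator G A B ↑F) : k ≤ F.card := by
  classical
  choose f hf hfF using fun i => hF (hs i) (ht i) (w i)
  have hinj : Function.Injective f := by
    intro i j h
    by_contra hij
    exact hdisj i j hij (hf i) (h ▸ hf j)
  calc k = Fintype.card (Fin k) := (Fintype.card_fin k).symm
    _ ≤ Fintype.card (↑F : Set (Sym2 V)) :=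
        Fintype.card_le_of_injective (fun i => ⟨f i, hfF i⟩) fun i j h => hinj (by simpa using h)
    _ = F.card := Fintype.card_of_subtype F fun _ => Finset.mem_coe.symm

/-! ### Walks of the line graph versus walks of the graph -/

/-- **From the line graph to the graph**: a walk of `G.lineGraph` from the edge `e` to the edge `f`,
and an endpoint `a` of `e`, yield a walk of `G` from `a` to an endpoint of `f` all of whose edges
are vertices of the given walk. [folklore] -/
theorem exists_walk_of_lineGraph_walk :
    ∀ {e f : G.edgeSet} (q : G.lineGraph.Walk e f) (a : V), a ∈ (e : Sym2 V) →
      ∃ (b : V) (w : G.Walk a b), b ∈ (f : Sym2 V) ∧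
        ∀ d ∈ w.edges, ∃ x ∈ q.support, (x : Sym2 V) = d
  | e, _, Walk.nil, a, ha => ⟨a, Walk.nil, ha, by simp⟩
  | e, f, Walk.cons (v := e') h q, a, ha => by
    obtain ⟨hne, s, hs, hs'⟩ := lineGraph_adj_iff_exists.1 h
    by_cases has : a = s
    · subst has
      obtain ⟨b, w, hb, hw⟩ := exists_walk_of_lineGraph_walk q a hs'
      refine ⟨b, w, hb, fun d hd => ?_⟩
      obtain ⟨x, hx, hxd⟩ := hw d hd
      exact ⟨x, by rw [Walk.support_cons]; exact List.mem_cons_of_mem _ hx, hxd⟩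
    · have he : (e : Sym2 V) = s(a, s) := (Sym2.mem_and_mem_iff has).1 ⟨ha, hs⟩
      have hadj : G.Adj a s := by
        have := e.2
        rwa [he] at this
      obtain ⟨b, w, hb, hw⟩ := exists_walk_of_lineGraph_walk q s hs'
      refine ⟨b, Walk.cons hadj w, hb, fun d hd => ?_⟩
      rw [Walk.edges_cons, List.mem_cons] at hd
      rcases hd with rfl | hd
      · exact ⟨e, Walk.start_mem_support _, he⟩
      · obtain ⟨x, hx, hxd⟩ := hw d hd
        exact ⟨x, by rw [Walk.support_cons]; exact List.mem_cons_of_mem _ hx, hxd⟩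

/-- **From the graph to the line graph**: a trail of `G` with at least one edge yields a walk of
`G.lineGraph` from an edge at its start to an edge at its end, along its edges. [folklore] -/
theorem exists_lineGraph_walk_of_isTrail :
    ∀ {u v : V} (p : G.Walk u v), p.IsTrail → 0 < p.length →
      ∃ (e f : G.edgeSet) (q : G.lineGraph.Walk e f), u ∈ (e : Sym2 V) ∧ v ∈ (f : Sym2 V) ∧
        ∀ x ∈ q.support, (x : Sym2 V) ∈ p.edges
  | _, _, Walk.nil, _, hl => by simp at hl
  | u, _, Walk.cons (v := w) h Walk.nil, _, _ =>
    ⟨⟨s(u, w), h⟩, ⟨s(u, w), h⟩, Walk.nil, Sym2.mem_mk_left _ _, Sym2.mem_mk_right _ _, by simp⟩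
  | u, v, Walk.cons (v := w) h (Walk.cons (v := w') h' p), ht, _ => by
    have ht' : (Walk.cons h' p).IsTrail := ht.of_cons
    obtain ⟨e', f, q', hwe', hvf, hq'⟩ :=
      exists_lineGraph_walk_of_isTrail (Walk.cons h' p) ht' (by simp)
    have hnot : s(u, w) ∉ (Walk.cons h' p).edges := by
      rw [Walk.isTrail_def, Walk.edges_cons, List.nodup_cons] at ht
      exact ht.1
    have hadj : G.lineGraph.Adj ⟨s(u, w), h⟩ e' := by
      rw [lineGraph_adj_iff_exists]
      refine ⟨fun hc => hnot ?_, w, Sym2.mem_mk_right _ _, hwe'⟩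
      have := hq' e' (Walk.start_mem_support _)
      rwa [← hc] at this
    refine ⟨⟨s(u, w), h⟩, f, Walk.cons hadj q', Sym2.mem_mk_left _ _, hvf, fun x hx => ?_⟩
    rw [Walk.support_cons, List.mem_cons] at hx
    rw [Walk.edges_cons, List.mem_cons]
    rcases hx with rfl | hx
    · exact Or.inl rfl
    · exact Or.inr (hq' x hx)

/-! ### The edge form of Menger's theorem -/

/-- The set of edges meeting a vertex set `A` (vertices of the line graph "at `A`").
[cite: Diestel2017, §3.3 (edge version)] -/
def lineVerticesAt (G : _root_.SimpleGraph V) (A : Set V) : Set G.edgeSet :=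
  {e | ∃ a ∈ A, a ∈ (e : Sym2 V)}

/-- **Edge separators are vertex separators of the line graph**: if `A ∩ B = ∅`, every finite
`(lineVerticesAt A)`–`(lineVerticesAt B)` separator `Z` of `G.lineGraph` is (as a set of edges) an `A`–`B` edge
separator of `G`. [cite: Diestel2017, Cor. 3.3.5 (proof)] -/
theorem isEdgeSeparator_of_isVxSeparator_lineGraph [DecidableEq V] {A B : Set V}
    (hAB : ∀ a ∈ A, a ∉ B) {Z : Finset G.edgeSet}
    (hZ : IsVxSeparator G.lineGraph (lineVerticesAt G A) (lineVerticesAt G B) ↑Z) :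
    IsEdgeSeparator G A B ↑(Z.image (fun x : G.edgeSet => (x : Sym2 V))) := by
  intro u v hu hv p
  have huv : u ≠ v := fun h => hAB u hu (h ▸ hv)
  have hlen : 0 < p.bypass.length :=
    Nat.pos_of_ne_zero fun h => huv (Walk.eq_of_length_eq_zero h)
  obtain ⟨e, f, q, hue, hvf, hq⟩ := exists_lineGraph_walk_of_isTrail p.bypass p.bypass_isPath.isTrail hlen
  obtain ⟨z, hz, hzZ⟩ := hZ ⟨u, hu, hue⟩ ⟨v, hv, hvf⟩ q
  refine ⟨z, p.edges_bypass_subset_edges (hq z hz), ?_⟩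
  rw [Finset.coe_image]
  exact ⟨z, hzZ, rfl⟩

/-- **Menger's theorem, edge form (max-flow = min-cut for unit capacities), sets version.** In a
finite graph, if every `A`–`B` edge separator has at least `k` edges, then there are `k` pairwise
edge-disjoint walks from `A` to `B`. Proof: if `A ∩ B ≠ ∅`, trivial walks; otherwise apply the set
form of Menger's theorem to the line graph between the edges at `A` and the edges at `B`, and pull
the disjoint paths back to `G`. [cite: Diestel2017, Cor. 3.3.5 (ii)] -/
theorem exists_edgeDisjoint_walks_of_forall_isEdgeSeparator [Fintype V] [DecidableEq V]
    (G : _root_.SimpleGraph V) [DecidableRel G.Adj] (A B : Set V) (k : ℕ)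
    (hk : ∀ F : Finset (Sym2 V), IsEdgeSeparator G A B ↑F → k ≤ F.card) :
    ∃ (s t : Fin k → V) (w : ∀ i, G.Walk (s i) (t i)), (∀ i, s i ∈ A) ∧ (∀ i, t i ∈ B) ∧
      ∀ i j, i ≠ j → List.Disjoint (w i).edges (w j).edges := by
  classical
  by_cases hAB : ∃ a ∈ A, a ∈ B
  · -- trivial walks at a vertex of `A ∩ B`
    obtain ⟨a, haA, haB⟩ := hAB
    exact ⟨fun _ => a, fun _ => a, fun _ => Walk.nil, fun _ => haA, fun _ => haB,
      fun i j _ => by simp⟩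
  · push Not at hAB
    -- vertex Menger in the line graph
    have hk' : ∀ Z : Finset G.edgeSet,
        IsVxSeparator G.lineGraph (lineVerticesAt G A) (lineVerticesAt G B) ↑Z → k ≤ Z.card := by
      intro Z hZ
      have h := hk _ (isEdgeSeparator_of_isVxSeparator_lineGraph hAB hZ)
      rwa [Finset.card_image_of_injective _ Subtype.coe_injective] at h
    obtain ⟨P⟩ := exists_abPathSystem_fin_of_forall_isVxSeparator G.lineGraph
      (lineVerticesAt G A) (lineVerticesAt G B) k hk'
    -- pull each path back to a walk of `G` from `A` to `B` along its edges
    have hpull : ∀ i : ULift.{u} (Fin k), ∃ (a b : V) (w : G.Walk a b), a ∈ A ∧ b ∈ B ∧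
        ∀ d ∈ w.edges, ∃ x ∈ (P.walk i).support, (x : Sym2 V) = d := by
      intro i
      obtain ⟨a, haA, hae⟩ := P.fst_mem i
      obtain ⟨b, w, hb, hw⟩ := exists_walk_of_lineGraph_walk (P.walk i) a hae
      obtain ⟨b', hb'B, hb'f⟩ := P.lst_mem i
      by_cases hbb' : b = b'
      · subst hbb'
        exact ⟨a, b, w, haA, hb'B, hw⟩
      · have hf : ((P.lst i : G.edgeSet) : Sym2 V) = s(b, b') :=
          (Sym2.mem_and_mem_iff hbb').1 ⟨hb, hb'f⟩
        have hadj : G.Adj b b' := by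
          have := (P.lst i).2
          rwa [hf] at this
        refine ⟨a, b', w.concat hadj, haA, hb'B, fun d hd => ?_⟩
        rw [Walk.edges_concat, List.concat_eq_append, List.mem_append, List.mem_singleton] at hd
        rcases hd with hd | rfl
        · exact hw d hd
        · exact ⟨P.lst i, Walk.end_mem_support _, hf⟩
    choose a b w ha hb hw using hpull
    refine ⟨fun i => a ⟨i⟩, fun i => b ⟨i⟩, fun i => w ⟨i⟩, fun i => ha ⟨i⟩, fun i => hb ⟨i⟩,
      fun i j hij d hdi hdj => ?_⟩
    obtain ⟨x, hx, hxd⟩ := hw ⟨i⟩ d hdi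
    obtain ⟨x', hx', hx'd⟩ := hw ⟨j⟩ d hdj
    have hxx' : x = x' := Subtype.ext (hxd.trans hx'd.symm)
    subst hxx'
    exact P.disjoint ⟨i⟩ ⟨j⟩ (fun h => hij (congrArg ULift.down h)) hx hx'

/-- **Max-flow = min-cut, packaged**: for every `k`, there are `k` pairwise edge-disjoint `A`–`B`
walks iff every `A`–`B` edge separator has at least `k` edges.
[cite: Diestel2017, Cor. 3.3.5 (ii)] -/
theorem exists_edgeDisjoint_walks_iff [Fintype V] [DecidableEq V] (G : _root_.SimpleGraph V)
    [DecidableRel G.Adj] (A B : Set V) (k : ℕ) :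
    (∃ (s t : Fin k → V) (w : ∀ i, G.Walk (s i) (t i)), (∀ i, s i ∈ A) ∧ (∀ i, t i ∈ B) ∧
      ∀ i j, i ≠ j → List.Disjoint (w i).edges (w j).edges) ↔
    ∀ F : Finset (Sym2 V), IsEdgeSeparator G A B ↑F → k ≤ F.card := by
  constructor
  · rintro ⟨s, t, w, hs, ht, hdisj⟩ F hF
    exact card_le_card_of_edgeDisjoint w hs ht hdisj hF
  · exact exists_edgeDisjoint_walks_of_forall_isEdgeSeparator G A B k

end Literature.Combinatorics.SimpleGraph
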